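import Literature.AlgebraicGeometry.AbelianSchemes.DualPairBaseQuotientDescent
import Literature.AlgebraicGeometry.AbelianSchemes.PoincareBaseQuotientDescentOfNoetherian
import HarnessLib

/-!
# The dual pair descends along a free finite quotient OF THE BASE — WITHOUT `Â` REDUCED
# ([MFK94] Ch. 7 §3 remark after Thm. 7.9, Lemma 7.11; [Mumford AV] §13 p. 125; [Milne AV] I §8; SGA 1 VIII 7.8)

Topic `AlgebraicGeometry/AbelianSchemes`; namespace `Literature.AlgebraicGeometry.AbelianSchemes.AbelianSchemeOver`.
THEOREMS ONLY (no definition, no named fact, no instance, no notation, no `sorry`; net Literature debt 0).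

★ `DualPairBaseQuotientDescent.exists_dualPair_fields_of_free_base_quotient` assembles, for a dual pair `D = (Â, 𝒫)` of `A/S`
and a free finite quotient `p : S → Q = S/G` of the base along which `A`, `Â` descend to `B`, `B̂` compatibly with `G`, a module
`𝒫_B` on `B ×_Q B̂` with ALL FOUR property fields of ★ `DualPair` for `(B̂, 𝒫_B)` and `(π ×_p π̂)^* 𝒫_B ≅ 𝒫` — under the
hypothesis `[IsReduced D.hat.X.left]`, inherited SOLELY from the sheaf step ★
`PoincareBaseQuotientDescent.exists_rigidified_poincare_desc_of_free_base_quotient` (the «cocycle for free» normalisation);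
the `Pic⁰` clause (★ `PoincareBaseQuotientDescentPicZero`) and the universality over `Q` (★ `DualPairBaseQuotientDescentUnique`
+ §3 `exists_classify_of_free_base_quotient`) carry no reducedness.  THIS FILE is the same head with `[IsReduced D.hat.X.left]
[IsLocallyNoetherian D.hat.X.left]` REPLACED BY `[IsLocallyNoetherian S]`, the sheaf step being ★
`PoincareBaseQuotientDescentOfNoetherian.exists_rigidified_poincare_desc_of_free_base_quotient'` (Stein property of
`A ×_S Â → Â` for `S` locally Noetherian, `Â` arbitrary); the assembly is otherwise ★ §4 token for token.

SETTING (as in ★ `DualPairBaseQuotientDescent`, minus reducedness).  `p : S → Q` an AFFINE geometric quotient of `S` by a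
FREE action `ρ` of the finite group `G`, locally of finite type; `S` and `Q` locally Noetherian; `A/S` with a dual pair
`D = (Â, 𝒫)`, `Â` ARBITRARY; `B`, `B̂` abelian schemes over `Q` (`B̂` separated) and `π : A → B`, `π̂ : Â → B̂` exhibiting `A`,
`Â` as the base changes of `B`, `B̂` along `p` as group schemes (`hAB`, `hÂB̂`); actions `ρA`, `ρÂ` of `G` on `A`, `Â` over `π`,
`π̂` covering `ρ` by isomorphisms of group schemes (`hA`, `hÂ`); the Poincaré clause `hP : ∀ g, (ρA(g) ×_{ρ(g)} ρÂ(g))^*𝒫 ≅ 𝒫`.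

* §1 **`exists_dualPair_fields_of_free_base_quotient'`** — THE HEAD: `∃ 𝒫_B` with `HasRank 𝒫_B 1`, rigidified, fibrewise
  `Pic⁰`, universal (`∃!`) over `Q`, and `(π ×_p π̂)^*𝒫_B ≅ 𝒫` — `Â` arbitrary.
* §2 `exists_dualPair_hat_eq_of_free_base_quotient'` / `nonempty_dualPair_of_free_base_quotient'` — the same packaged as a term
  `D_B : B.DualPair` with `D_B.hat = B̂`, resp. as `Nonempty B.DualPair`.

Cell `hodgecm-mathlib` (D-0151), FLOOR 0 programme P1, sub-line `Cruxes/HDel/Lines/F3DualAbelianScheme` (author of record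
B-plan1 (g19)), stub (M) `stub_F3M` = Mumford's construction `Â := A ⁄ K(L)` over a Noetherian affine `ℚ`-base, inner step (M-d):
«Galois base-quotient descent of the dual pair from `S′` to the affine opens of `Spec R` (★ `exists_dualPair_fields_of_free_base_quotient`
— its `[IsReduced]` hypothesis must be REMOVED)» — over a non-reduced Noetherian `ℚ`-algebra `R` the étale-local dual `Â′` of
`A ×_R S′` is not reduced.  This file is that removal (the object half — descending `Â′` itself to `B̂` — is ★
`AbelianSchemeBaseQuotientDescent`, unchanged; price-sheet LACK (Q2c) is the remaining OBJECT-descent input of (M-d)).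
Count-neutral; HC_CM is proved only modulo the 7 printed citations until rung 0 closes; this file discharges none of them.

Mathlib searched (pin): `MorphismProperty.pullback_snd` (`IsAffineHom`, `Flat`, `Surjective`), `Subtype.ext` (used); Mathlib
has no quotients of schemes by finite groups and no dual abelian schemes.

## References
* D. Mumford, J. Fogarty, F. Kirwan, *Geometric Invariant Theory*, 3rd ed. (1994), Ch. 6 §1 Cor. 6.8 (p. 118), §2
  (p. 121); Ch. 7 §3, remark after Thm. 7.9 and Lemma 7.11 (pp. 139–140). [MumfordFogartyKirwan1994]
* D. Mumford, *Abelian Varieties* (1970), §5 Cor. 6 (p. 54), §13 (Thm. p. 125 and its proof). [MumfordAV1970]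
* J. S. Milne, *Abelian Varieties* (v2.00, 2008), I §8 pp. 36–37. [MilneAV2008]
* A. Grothendieck, *SGA 1*, Exp. VIII Thm. 1.1, Cor. 7.8; Exp. V Prop. 2.6, Déf. 2.7. [SGA1]
* U. Görtz, T. Wedhorn, *Algebraic Geometry I*, 2nd ed. (2020), Prop. 4.16 (p. 101), Thm. 14.72; *Algebraic Geometry II*
  (2023), Cor. 24.63 (p. 404). [GortzWedhorn2020] [GortzWedhorn2023]
-/

noncomputable section

universe u

open CategoryTheory Limits AlgebraicGeometry MonoidalCategory CartesianMonoidalCategory MonObj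

namespace Literature.AlgebraicGeometry.AbelianSchemes.AbelianSchemeOver

open Literature.AlgebraicGeometry.RelativeSpec Literature.AlgebraicGeometry.RelativeSpec.ActionOver
  Literature.AlgebraicGeometry.Modules Literature.AlgebraicGeometry.Motives
  Literature.AlgebraicGeometry.AbelianVarieties Literature.AlgebraicGeometry.Morphisms

set_option backward.isDefEq.respectTransparency false

variable {S Q : Scheme.{u}} {p : S ⟶ Q} {G : Type u} [Group G] [Fintype G] {ρ : ActionOver p G}
  (hq : ρ.IsGeometricQuotient p) [IsAffineHom p]
  (hfree : ∀ (V : Q.Opens), IsAffineOpen V → ∀ g : G, g ≠ 1 →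
    Ideal.span (Set.range fun s : Γ(S, p ⁻¹ᵁ V) ↦ ρ.act g V s - s) = ⊤)
  (A : AbelianSchemeOver S) (D : A.DualPair)
  (B : AbelianSchemeOver Q) {π : A.X.left ⟶ B.X.left} (ρA : ActionOver π G) (hAB : A.IsBaseChangeVia B p π)
  (hA : ∀ g : G, A.IsBaseChangeVia A (ρ.aut g).hom (ρA.aut g).hom)
  (Bh : AbelianSchemeOver Q) {πh : D.hat.X.left ⟶ Bh.X.left} (ρh : ActionOver πh G)
  (hABh : D.hat.IsBaseChangeVia Bh p πh)
  (hAh : ∀ g : G, D.hat.IsBaseChangeVia D.hat (ρ.aut g).hom (ρh.aut g).hom)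

/-! ### §1 Assembly: the four `DualPair` property fields of `(B̂, 𝒫_B)` and the Poincaré clause, `Â` arbitrary -/

include hq hfree in
/-- **THE DUAL PAIR DESCENDS ALONG A FREE FINITE QUOTIENT OF THE BASE — `Â` ARBITRARY (property fields + Poincaré clause).**
In the SETTING of ★ `AbelianSchemeBaseQuotientDescent` doubled — `p : S → Q = S/G` a free affine geometric quotient,
locally of finite type, `S` and `Q` locally Noetherian; `A/S` with a dual pair `D = (Â, 𝒫)`, NO hypothesis on `Â`; `B`, `B̂`
abelian schemes over `Q` (`B̂` separated) with `π : A → B`, `π̂ : Â → B̂` exhibiting `A`, `Â` as base changes along `p` as group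
schemes; `G`-actions `ρA`, `ρÂ` over `π`, `π̂` covering `ρ` by isomorphisms of group schemes; and the POINCARÉ CLAUSE
`(ρA(g) ×_{ρ(g)} ρÂ(g))^*𝒫 ≅ 𝒫` for all `g` (no cocycle asked) — there is a module `𝒫_B` on `B ×_Q B̂` satisfying ALL FOUR
property fields of ★ `DualPair` for `(B̂, 𝒫_B)`: a line bundle (`HasRank 𝒫_B 1`), rigidified along `ε_B × 1_{B̂}`, fibrewise in
`Pic⁰` over `B̂`, and UNIVERSAL over `Q` (`∃!` classifying morphism for every rigidified fibrewise-`Pic⁰` family on every `B_T`),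
TOGETHER WITH `(π ×_p π̂)^* 𝒫_B ≅ 𝒫`.  So `⟨B̂, 𝒫_B, …⟩ : B.DualPair` (term mode) is a dual pair of `B` of which `D` is the base
change along `p`.  (★ `PoincareBaseQuotientDescentOfNoetherian`: the sheaf, Stein over the locally Noetherian `S`; ★
`PoincareBaseQuotientDescentPicZero`: clause (a); ★ `DualPairBaseQuotientDescentUnique` + ★ `exists_classify_of_free_base_quotient`:
universality.)  ★ `exists_dualPair_fields_of_free_base_quotient` with `[IsReduced D.hat.X.left] [IsLocallyNoetherian D.hat.X.left]`
replaced by `[IsLocallyNoetherian S]` — the form Mumford's construction `Â = A/K(L)` over a (possibly non-reduced) Noetherian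
`ℚ`-algebra consumes at its Galois base-quotient step.
[cite: MumfordFogartyKirwan1994, Ch. 7 §3, remark after Thm. 7.9 and Lemma 7.11 (pp. 139–140)]
[cite: MumfordFogartyKirwan1994, Ch. 6 §1 Cor. 6.8 (p. 118) and §2 (p. 121)] [cite: MumfordAV1970, §13 (p. 125)]
[cite: MilneAV2008, I §8 pp. 36–37] [cite: SGA1, Exp. VIII Cor. 7.8] -/
theorem exists_dualPair_fields_of_free_base_quotient' [IsLocallyNoetherian S]
    [IsLocallyNoetherian Q] [LocallyOfFiniteType p] [Bh.X.left.IsSeparated]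
    (hP : ∀ g : G, Nonempty ((Scheme.Modules.pullback
      (pullback.map A.X.hom D.hat.X.hom A.X.hom D.hat.X.hom (ρA.aut g).hom (ρh.aut g).hom (ρ.aut g).hom
        (hA g).fst.symm (hAh g).fst.symm)).obj D.P ≅ D.P)) :
    ∃ PB : (B.prodLeft Bh).Modules, HasRank PB 1 ∧
      Nonempty ((Scheme.Modules.pullback (B.unitSlice Bh)).obj PB ≅ SheafOfModules.unit _) ∧
      (∀ (Ω : Type u) [Field Ω] [IsAlgClosed Ω] (b : Spec (.of Ω) ⟶ Bh.X.left),
        IsHomogeneous (B.fibre (b ≫ Bh.X.hom)).toAbelianVariety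
          ((Scheme.Modules.pullback (B.fibreSlice Bh b)).obj PB)) ∧
      (∀ {T : Scheme.{u}} (f : T ⟶ Q) (ℒ : B.RigidifiedLineBundle f), ℒ.FibrewisePicZero →
        ∃! g : {g : T ⟶ Bh.X.left // g ≫ Bh.X.hom = f},
          Nonempty ((Scheme.Modules.pullback (B.baseChangeToProd Bh f g.1 g.2)).obj PB ≅ ℒ.L)) ∧
      Nonempty ((Scheme.Modules.pullback
        (pullback.map A.X.hom D.hat.X.hom B.X.hom Bh.X.hom π πh p hAB.fst.symm hABh.fst.symm)).obj PB ≅ D.P) := by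
  haveI : Surjective p := ⟨hq.surjective⟩
  haveI : Flat p := hq.flat_of_free hfree
  obtain ⟨PB, h1, hrig, eP⟩ :=
    exists_rigidified_poincare_desc_of_free_base_quotient' hq hfree A D B ρA hAB hA Bh ρh hABh hAh hP
  refine ⟨PB, h1, hrig, fun Ω _ _ b => ?_, fun f ℒ hℒ => ?_, eP⟩
  · exact isHomogeneous_fibreSlice_of_pullback_prodQuotientMap_iso A D B hAB Bh hABh PB h1 hrig eP Ω b
  · obtain ⟨g, ⟨e⟩⟩ := exists_classify_of_free_base_quotient hq hfree A D B ρA hAB hA Bh ρh hABh hAh PB h1 hrig eP hP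
      f ℒ hℒ
    exact ⟨g, ⟨e⟩, fun g' ⟨e'⟩ => Subtype.ext
      (eq_of_pullback_baseChangeToProd_iso_of_base_quotient A D B hAB Bh hABh PB eP f g'.1 g.1 g'.2 g.2
        ⟨e' ≪≫ e.symm⟩)⟩

/-! ### §2 Packaging: the descended dual pair as a term of ★ `DualPair`, `Â` arbitrary -/

include hq hfree hAB hABh in
/-- **THE DESCENDED DUAL PAIR, PACKAGED** (`Â` arbitrary): in the SETTING of §1 there is a dual pair `D_B : B.DualPair` of the
descended abelian scheme `B/Q` WITH `D_B.hat = B̂` (the given descent of `Â`) — §1's property fields assembled into the ★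
`AbelianSchemeOver.DualPair` record (the Poincaré clause `(π ×_p π̂)^* 𝒫_B ≅ 𝒫` stays available field-level in §1).  This is
the conclusion shape the (M-d) step of Mumford's construction consumes (`B` the descent of `A ×_R S′` to `Spec R`).
[cite: MumfordFogartyKirwan1994, Ch. 6 §1 Cor. 6.8 (p. 118) and §2 (p. 121)] [cite: MumfordAV1970, §13 (p. 125)]
[cite: MilneAV2008, I §8 pp. 36–37] -/
theorem exists_dualPair_hat_eq_of_free_base_quotient' [IsLocallyNoetherian S]
    [IsLocallyNoetherian Q] [LocallyOfFiniteType p] [Bh.X.left.IsSeparated]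
    (hP : ∀ g : G, Nonempty ((Scheme.Modules.pullback
      (pullback.map A.X.hom D.hat.X.hom A.X.hom D.hat.X.hom (ρA.aut g).hom (ρh.aut g).hom (ρ.aut g).hom
        (hA g).fst.symm (hAh g).fst.symm)).obj D.P ≅ D.P)) :
    ∃ DB : B.DualPair, DB.hat = Bh := by
  obtain ⟨PB, h1, hrig, hpz, huniv, -⟩ :=
    exists_dualPair_fields_of_free_base_quotient' hq hfree A D B ρA hAB hA Bh ρh hABh hAh hP
  exact ⟨⟨Bh, PB, h1, hrig, hpz, fun f ℒ hℒ => huniv f ℒ hℒ⟩, rfl⟩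

include hq hfree hAB hABh in
/-- **`B` HAS A DUAL PAIR** (`Â` arbitrary) — the bare existence form of §2: an abelian scheme over a locally Noetherian `Q`
whose base change along a free finite quotient `S → Q` (locally of finite type, `S` locally Noetherian) carries a dual pair
`(Â, 𝒫)` which, together with `Â`'s descent `B̂` (separated), is `G`-compatible (`hA`, `hÂ`, Poincaré clause `hP`), has a dual
pair. [cite: MumfordFogartyKirwan1994, Ch. 6 §1 Cor. 6.8 (p. 118)] [cite: MumfordAV1970, §13 (p. 125)] -/
theorem nonempty_dualPair_of_free_base_quotient' [IsLocallyNoetherian S]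
    [IsLocallyNoetherian Q] [LocallyOfFiniteType p] [Bh.X.left.IsSeparated]
    (hP : ∀ g : G, Nonempty ((Scheme.Modules.pullback
      (pullback.map A.X.hom D.hat.X.hom A.X.hom D.hat.X.hom (ρA.aut g).hom (ρh.aut g).hom (ρ.aut g).hom
        (hA g).fst.symm (hAh g).fst.symm)).obj D.P ≅ D.P)) :
    Nonempty B.DualPair := by
  obtain ⟨DB, -⟩ := exists_dualPair_hat_eq_of_free_base_quotient' hq hfree A D B ρA hAB hA Bh ρh hABh hAh hP
  exact ⟨DB⟩

end Literature.AlgebraicGeometry.AbelianSchemes.AbelianSchemeOver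

end
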